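import Summits.HubbardSuperconductivity.HubbardSuperconductivity.Theorems.BalabanIRBirBdGPhaseCoercivityGlueReal
import Summits.HubbardSuperconductivity.HubbardSuperconductivity.Theorems.BalabanIRBirBdGPhaseCoercivityPolyApprox
import Summits.HubbardSuperconductivity.HubbardSuperconductivity.Theorems.BalabanIRBirBdGPhaseCoercivityReduction

/-!
# Route BalabanIR — crux 3 `BirBdGPhaseCoercivity` (item `stmt-HubbardSuperconductivity-2081`):
# XV. The point certificate: the crux's conclusion at one parameter point from one-variable data

END POINT OF THE TWO-LAYER REDUCTION (files I–XIV). Fix `(μ, Δ₁, Δ₂)` with `μ ∈ (-4,4)`, `Δ₁Δ₂ ≠ 0`.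
Given
 (P)  a real polynomial `P` and an interval `[lo, hi]` with `|y^{-1/2} - P(y)| ≤ δ` on `[lo, hi]`
      and `E(θ)² = ξ(θ)² + |Δ(θ)|² ∈ [lo, hi]` for all angles (`lo > 0` is a certified spectral-gap bound,
      `hi` may be taken crude, `norm_sq_gap_le_crude`),
 (T)  the coordinate-degree-2 trigonometric inequality
      `κ ε(θ) ≤ Re Σ_{r,r'∈B} c_r conj(c_{r'}) w_{rr'}(θ) a_{r'-r}` on `ℝ²` for the 25 low coefficients `a_ρ`,
      `|ρ|_∞ ≤ 2`, of `P(E²)` in `ℂ[ℤ²]` (`a := (aeval E2A (P.map ofReal)).coeff`),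
 (K)  `2c₀ + 96(|Δ₁|+|Δ₂|)² δ ≤ κ`,
the conclusion of `BirBdGPhaseCoercivity` holds at `(μ,Δ₁,Δ₂)` with constant `c₀` on every torus of side
`L ≥ 2 deg P + 3` (`coercive_of_polynomialCertificate`). No matrices, no eigenvalues, no `L`, no texture:
what is left per parameter point is a one-variable polynomial bound and a small trigonometric positivity
certificate — finite, certifiable computations.

References: evidence notes on the item. No definition is introduced.
-/

noncomputable section

namespace Summit.HubbardSuperconductivity.HubbardSuperconductivity.Theorems

namespace BirBdG

open Finset Literature.Probability.LatticeModels
open scoped ComplexConjugate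

/-- A crude upper bound for `E(θ)²`: `ξ² + |Δ|² ≤ (4 + |μ|)² + (4|Δ₁| + 4|Δ₂|)²`. [folklore] -/
theorem norm_sq_gap_le_crude (μ Δ₁ Δ₂ θ₀ θ₁ : ℝ) :
    (-2 * Real.cos θ₀ - 2 * Real.cos θ₁ - μ) ^ 2 +
        ‖((2 * Δ₁ * (Real.cos θ₀ - Real.cos θ₁) : ℝ) : ℂ) -
          4 * Complex.I * ((Δ₂ * Real.sin θ₀ * Real.sin θ₁ : ℝ) : ℂ)‖ ^ 2 ≤
      (4 + |μ|) ^ 2 + (4 * |Δ₁| + 4 * |Δ₂|) ^ 2 := by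
  have hc0 := Real.abs_cos_le_one θ₀
  have hc1 := Real.abs_cos_le_one θ₁
  have hs0 := Real.abs_sin_le_one θ₀
  have hs1 := Real.abs_sin_le_one θ₁
  have hξ : |-2 * Real.cos θ₀ - 2 * Real.cos θ₁ - μ| ≤ 4 + |μ| := by
    calc |-2 * Real.cos θ₀ - 2 * Real.cos θ₁ - μ| ≤ |-2 * Real.cos θ₀ - 2 * Real.cos θ₁| + |μ| := abs_sub _ _
      _ ≤ (|-2 * Real.cos θ₀| + |2 * Real.cos θ₁|) + |μ| := by gcongr; exact abs_sub _ _
      _ ≤ 4 + |μ| := by rw [abs_mul, abs_mul, abs_neg, abs_two]; linarith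
  have hΔ : ‖((2 * Δ₁ * (Real.cos θ₀ - Real.cos θ₁) : ℝ) : ℂ) -
      4 * Complex.I * ((Δ₂ * Real.sin θ₀ * Real.sin θ₁ : ℝ) : ℂ)‖ ≤ 4 * |Δ₁| + 4 * |Δ₂| := by
    refine (norm_sub_le _ _).trans ?_
    have h1 : |Real.cos θ₀ - Real.cos θ₁| ≤ 2 := by
      have := abs_sub (Real.cos θ₀) (Real.cos θ₁); linarith
    have t1 : ‖((2 * Δ₁ * (Real.cos θ₀ - Real.cos θ₁) : ℝ) : ℂ)‖ ≤ 4 * |Δ₁| := by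
      rw [Complex.norm_real, Real.norm_eq_abs, abs_mul, abs_mul, abs_two]
      nlinarith [abs_nonneg Δ₁, abs_nonneg (Real.cos θ₀ - Real.cos θ₁)]
    have t2 : ‖4 * Complex.I * ((Δ₂ * Real.sin θ₀ * Real.sin θ₁ : ℝ) : ℂ)‖ ≤ 4 * |Δ₂| := by
      rw [norm_mul, norm_mul, Complex.norm_I, mul_one, Complex.norm_real, Real.norm_eq_abs, abs_mul, abs_mul,
        show ‖(4 : ℂ)‖ = 4 by norm_num]
      have h2 : |Real.sin θ₀| * |Real.sin θ₁| ≤ 1 := by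
        nlinarith [abs_nonneg (Real.sin θ₀), abs_nonneg (Real.sin θ₁)]
      nlinarith [abs_nonneg Δ₂, abs_nonneg (Real.sin θ₀), abs_nonneg (Real.sin θ₁)]
    linarith
  have h1 : (-2 * Real.cos θ₀ - 2 * Real.cos θ₁ - μ) ^ 2 ≤ (4 + |μ|) ^ 2 := by
    rw [← sq_abs (-2 * Real.cos θ₀ - 2 * Real.cos θ₁ - μ)]
    exact pow_le_pow_left₀ (abs_nonneg _) hξ 2
  have h2 := pow_le_pow_left₀ (norm_nonneg _) hΔ 2
  linarith

/-- **The point certificate.** See the module docstring: at `(μ,Δ₁,Δ₂)` with the gap open, a polynomial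
`P` with the one-variable bound (P) on `[lo,hi] ∋ E²`, the degree-2 inequality (T) for the low coefficients
of `P(E²)` and the bookkeeping (K) give the conclusion of `BirBdGPhaseCoercivity` with constant `c₀` on
every torus of side `L ≥ 2 deg P + 3`. [folklore] -/
theorem coercive_of_polynomialCertificate (μ Δ₁ Δ₂ c₀ κ δ lo hi : ℝ) (P : Polynomial ℝ)
    (hμ : μ ∈ Set.Ioo (-4 : ℝ) 4) (h₁ : Δ₁ ≠ 0) (h₂ : Δ₂ ≠ 0)
    (hP : ∀ y ∈ Set.Icc lo hi, |(Real.sqrt y)⁻¹ - P.eval y| ≤ δ)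
    (hrange : ∀ θ₀ θ₁ : ℝ, (-2 * Real.cos θ₀ - 2 * Real.cos θ₁ - μ) ^ 2 +
        ‖((2 * Δ₁ * (Real.cos θ₀ - Real.cos θ₁) : ℝ) : ℂ) -
          4 * Complex.I * ((Δ₂ * Real.sin θ₀ * Real.sin θ₁ : ℝ) : ℂ)‖ ^ 2 ∈ Set.Icc lo hi)
    (hT : ∀ θ₀ θ₁ : ℝ, κ * (4 - 2 * Real.cos θ₀ - 2 * Real.cos θ₁) ≤
      (∑ r ∈ ({(1, 0), (-1, 0), (0, 1), (0, -1), (1, 1), (-1, -1), (1, -1), (-1, 1)} : Finset (ℤ × ℤ)),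
        ∑ r' ∈ ({(1, 0), (-1, 0), (0, 1), (0, -1), (1, 1), (-1, -1), (1, -1), (-1, 1)} : Finset (ℤ × ℤ)),
        (if (r = (1, 0) ∨ r = (-1, 0)) then (Δ₁ : ℂ) else if (r = (0, 1) ∨ r = (0, -1)) then -(Δ₁ : ℂ)
          else if (r = (1, 1) ∨ r = (-1, -1)) then Complex.I * (Δ₂ : ℂ) else -(Complex.I * (Δ₂ : ℂ))) *
        conj ((if (r' = (1, 0) ∨ r' = (-1, 0)) then (Δ₁ : ℂ) else if (r' = (0, 1) ∨ r' = (0, -1)) then -(Δ₁ : ℂ)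
          else if (r' = (1, 1) ∨ r' = (-1, -1)) then Complex.I * (Δ₂ : ℂ) else -(Complex.I * (Δ₂ : ℂ)))) *
        (((3 - Real.cos (r.1 * θ₀ + r.2 * θ₁) - Real.cos (r'.1 * θ₀ + r'.2 * θ₁)
            - Real.cos ((r.1 - r'.1) * θ₀ + (r.2 - r'.2) * θ₁)) / 2 : ℝ) : ℂ) *
        (Polynomial.aeval ((AddMonoidAlgebra.single ((0 : ℤ), (0 : ℤ)) (-(μ : ℂ)) - AddMonoidAlgebra.single ((1 : ℤ), (0 : ℤ)) (1 : ℂ)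
          - AddMonoidAlgebra.single ((-1 : ℤ), (0 : ℤ)) (1 : ℂ) - AddMonoidAlgebra.single ((0 : ℤ), (1 : ℤ)) (1 : ℂ)
          - AddMonoidAlgebra.single ((0 : ℤ), (-1 : ℤ)) (1 : ℂ)) *
        (AddMonoidAlgebra.single ((0 : ℤ), (0 : ℤ)) (-(μ : ℂ)) - AddMonoidAlgebra.single ((1 : ℤ), (0 : ℤ)) (1 : ℂ)
          - AddMonoidAlgebra.single ((-1 : ℤ), (0 : ℤ)) (1 : ℂ) - AddMonoidAlgebra.single ((0 : ℤ), (1 : ℤ)) (1 : ℂ)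
          - AddMonoidAlgebra.single ((0 : ℤ), (-1 : ℤ)) (1 : ℂ)) +
        (∑ r ∈ ({(1, 0), (-1, 0), (0, 1), (0, -1), (1, 1), (-1, -1), (1, -1), (-1, 1)} : Finset (ℤ × ℤ)), AddMonoidAlgebra.single r ((fun r : ℤ × ℤ => if (r = (1, 0) ∨ r = (-1, 0)) then (Δ₁ : ℂ) else if (r = (0, 1) ∨ r = (0, -1)) then -(Δ₁ : ℂ)
          else if (r = (1, 1) ∨ r = (-1, -1)) then Complex.I * (Δ₂ : ℂ) else -(Complex.I * (Δ₂ : ℂ))) r)) *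
        (∑ r ∈ ({(1, 0), (-1, 0), (0, 1), (0, -1), (1, 1), (-1, -1), (1, -1), (-1, 1)} : Finset (ℤ × ℤ)), AddMonoidAlgebra.single (-r) (conj ((fun r : ℤ × ℤ => if (r = (1, 0) ∨ r = (-1, 0)) then (Δ₁ : ℂ) else if (r = (0, 1) ∨ r = (0, -1)) then -(Δ₁ : ℂ)
          else if (r = (1, 1) ∨ r = (-1, -1)) then Complex.I * (Δ₂ : ℂ) else -(Complex.I * (Δ₂ : ℂ))) r)))
        : AddMonoidAlgebra ℂ (ℤ × ℤ)) (P.map (algebraMap ℝ ℂ))).coeff (r' - r)).re)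
    (hκ : 2 * c₀ + 96 * (|Δ₁| + |Δ₂|) ^ 2 * δ ≤ κ)
    (L : ℕ) [NeZero L] (hL : 2 * P.natDegree + 3 ≤ L) :
    let nnx : Literature.Probability.LatticeModels.TorusSite 2 L → Literature.Probability.LatticeModels.TorusSite 2 L → Prop := fun x y => y = x + ![1, 0] ∨ y = x + ![-1, 0]; let nny : Literature.Probability.LatticeModels.TorusSite 2 L → Literature.Probability.LatticeModels.TorusSite 2 L → Prop := fun x y => y = x + ![0, 1] ∨ y = x + ![0, -1]; let dg1 : Literature.Probability.LatticeModels.TorusSite 2 L → Literature.Probability.LatticeModels.TorusSite 2 L → Prop := fun x y => y = x + ![1, 1] ∨ y = x + ![-1, -1]; let dg2 : Literature.Probability.LatticeModels.TorusSite 2 L → Literature.Probability.LatticeModels.TorusSite 2 L → Prop := fun x y => y = x + ![1, -1] ∨ y = x + ![-1, 1]; let h : Matrix (Literature.Probability.LatticeModels.TorusSite 2 L) (Literature.Probability.LatticeModels.TorusSite 2 L) ℂ := fun x y => -(if nnx x y ∨ nny x y then (1 : ℂ) else 0) - (if x = y then (μ : ℂ) else 0); let D : (Literature.Probability.LatticeModels.TorusSite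 2 L → ℝ) → Matrix (Literature.Probability.LatticeModels.TorusSite 2 L) (Literature.Probability.LatticeModels.TorusSite 2 L) ℂ := fun θ x y => ((Δ₁ : ℂ) * ((if nnx x y then (1 : ℂ) else 0) - (if nny x y then (1 : ℂ) else 0)) + Complex.I * (Δ₂ : ℂ) * ((if dg1 x y then (1 : ℂ) else 0) - (if dg2 x y then (1 : ℂ) else 0))) * (Complex.exp (Complex.I * (θ x : ℂ)) + Complex.exp (Complex.I * (θ y : ℂ))) / 2; let Hb : (Literature.Probability.LatticeModels.TorusSite 2 L → ℝ) → Matrix (Literature.Probability.LatticeModels.TorusSite 2 L ⊕ Literature.Probability.LatticeModels.TorusSite 2 L) (Literature.Probability.LatticeModels.TorusSite 2 L ⊕ Literature.Probability.LatticeModels.TorusSite 2 L) ℂ := fun θ => Matrix.fromBlocks h (D θ) (Matrix.conjTranspose (D θ)) (-h); ∀ θ : Literature.Probability.LatticeModels.TorusSite 2 L → ℝ, ∀ (hθ : (Hb θ).IsHermitian) (h0 : (Hb (fun _ => 0)).IsHermitian), c₀ * ∑ x : Literature.Probability.LatticeModels.TorusSite 2 L, ∑ y : Literature.Probability.LatticeModels.TorusSite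 2 L, (if nnx x y ∨ nny x y then (1 - Real.cos (θ x - θ y)) else 0) ≤ ∑ i, |h0.eigenvalues i| - ∑ i, |hθ.eigenvalues i| := by
  have hL3 : 3 ≤ L := le_trans (Nat.le_add_left 3 _) hL
  refine coercive_of_symbolIneq μ Δ₁ Δ₂ c₀ hL3 hμ h₁ h₂
    (fun k => -2 * Real.cos (latticeMomentum L k 0) - 2 * Real.cos (latticeMomentum L k 1) - μ)
    (fun k => Real.sqrt ((-2 * Real.cos (latticeMomentum L k 0) - 2 * Real.cos (latticeMomentum L k 1) - μ) ^ 2 +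
      ‖((2 * Δ₁ * (Real.cos (latticeMomentum L k 0) - Real.cos (latticeMomentum L k 1)) : ℝ) : ℂ) -
        4 * Complex.I * ((Δ₂ * Real.sin (latticeMomentum L k 0) * Real.sin (latticeMomentum L k 1) : ℝ) : ℂ)‖ ^ 2))
    (fun k => ((2 * Δ₁ * (Real.cos (latticeMomentum L k 0) - Real.cos (latticeMomentum L k 1)) : ℝ) : ℂ) -
      4 * Complex.I * ((Δ₂ * Real.sin (latticeMomentum L k 0) * Real.sin (latticeMomentum L k 1) : ℝ) : ℂ))
    (fun _ => rfl) (fun _ => rfl) (fun _ => rfl) ?_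
  intro q _
  exact symbolIneq_dplusid_of_realData μ Δ₁ Δ₂ c₀ κ δ hμ h₁ h₂
    (Polynomial.aeval ((AddMonoidAlgebra.single ((0 : ℤ), (0 : ℤ)) (-(μ : ℂ)) - AddMonoidAlgebra.single ((1 : ℤ), (0 : ℤ)) (1 : ℂ)
          - AddMonoidAlgebra.single ((-1 : ℤ), (0 : ℤ)) (1 : ℂ) - AddMonoidAlgebra.single ((0 : ℤ), (1 : ℤ)) (1 : ℂ)
          - AddMonoidAlgebra.single ((0 : ℤ), (-1 : ℤ)) (1 : ℂ)) *
        (AddMonoidAlgebra.single ((0 : ℤ), (0 : ℤ)) (-(μ : ℂ)) - AddMonoidAlgebra.single ((1 : ℤ), (0 : ℤ)) (1 : ℂ)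
          - AddMonoidAlgebra.single ((-1 : ℤ), (0 : ℤ)) (1 : ℂ) - AddMonoidAlgebra.single ((0 : ℤ), (1 : ℤ)) (1 : ℂ)
          - AddMonoidAlgebra.single ((0 : ℤ), (-1 : ℤ)) (1 : ℂ)) +
        (∑ r ∈ ({(1, 0), (-1, 0), (0, 1), (0, -1), (1, 1), (-1, -1), (1, -1), (-1, 1)} : Finset (ℤ × ℤ)), AddMonoidAlgebra.single r ((fun r : ℤ × ℤ => if (r = (1, 0) ∨ r = (-1, 0)) then (Δ₁ : ℂ) else if (r = (0, 1) ∨ r = (0, -1)) then -(Δ₁ : ℂ)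
          else if (r = (1, 1) ∨ r = (-1, -1)) then Complex.I * (Δ₂ : ℂ) else -(Complex.I * (Δ₂ : ℂ))) r)) *
        (∑ r ∈ ({(1, 0), (-1, 0), (0, 1), (0, -1), (1, 1), (-1, -1), (1, -1), (-1, 1)} : Finset (ℤ × ℤ)), AddMonoidAlgebra.single (-r) (conj ((fun r : ℤ × ℤ => if (r = (1, 0) ∨ r = (-1, 0)) then (Δ₁ : ℂ) else if (r = (0, 1) ∨ r = (0, -1)) then -(Δ₁ : ℂ)
          else if (r = (1, 1) ∨ r = (-1, -1)) then Complex.I * (Δ₂ : ℂ) else -(Complex.I * (Δ₂ : ℂ))) r)))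
        : AddMonoidAlgebra ℂ (ℤ × ℤ)) (P.map (algebraMap ℝ ℂ))).coeff (2 * P.natDegree)
    (fun ρ hρ => support_aeval_E2A P μ Δ₁ Δ₂ ρ hρ)
    (approx_of_polynomial P lo hi δ μ Δ₁ Δ₂ hP hrange) hT hκ L hL _ _ _
    (fun _ => rfl) (fun _ => rfl) (fun _ => rfl) q

end BirBdG

end Summit.HubbardSuperconductivity.HubbardSuperconductivity.Theorems

end
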